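import Summits.RiemannHypothesis.RiemannHypothesis.Theorems.WeilFormatCCinfTruncate
import HarnessLib

/-!
# Format C, design C∞ (E3, analytic side): re-indexing a truncated family sum to the short index `Fin 4 × Fin (E₀+1)`

Route context: Fourier–Galerkin / Schur-complement certificates of Weil positivity on a window ("format C", C∞ door;
cell memo `run/shared/lean/pub/rh-explicit/rh-explicit-weil-10/KERNEL-LEVER.md` §21; supporting stmt-RiemannHypothesis-0098;
seat rh-explicit-weil-10).  `collected_truncate` zeroes the coefficients of power `> E₀` but keeps the long family index
`Fin 4 × Fin (D+1)`.  Here the zeroed sum is re-indexed to `Fin 4 × Fin (E₀+1)` (`E₀ ≤ D`), so the rung's family data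
(`φ`, the Gram entry boxes of `sum_Ico_sq_sum_mul_le_of_boxes_fintype`) live on the short index:

* `sum_fin_succ_trunc_eq` — `Σ_{d : Fin (D+1)} [d ≤ E₀]·F(d) = Σ_{d : Fin (E₀+1)} F(castLE d)`;
* `sum_trunc_eq_sum_castLE` — the product-index version used by the collected objects;
* `collected_truncate_short` — `collected_truncate` with the conclusion over `Fin 4 × Fin (E₀+1)`.

Elementary; standard axioms; no definitions; no RH claim.
-/

set_option autoImplicit false
-- `Summit.RiemannHypothesis.RiemannHypothesis.…` is the layout-mandated namespace (summit = problem name).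
set_option linter.dupNamespace false

noncomputable section

open Finset
open scoped BigOperators Real ArithmeticFunction.vonMangoldt

namespace Summit.RiemannHypothesis.RiemannHypothesis.Theorems.WeilFormatC

open Literature.NumberTheory.LFunctions

variable {a : ℝ}

/-- Truncated sum over `Fin (D+1)` = full sum over `Fin (E₀+1)` through `Fin.castLE` (`E₀ ≤ D`). -/
theorem sum_fin_succ_trunc_eq {D E₀ : ℕ} (hE : E₀ ≤ D) (F : Fin (D + 1) → ℝ) :
    ∑ d : Fin (D + 1), (if (d : ℕ) ≤ E₀ then F d else 0)
      = ∑ d : Fin (E₀ + 1), F (Fin.castLE (by omega) d) := by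
  classical
  -- the right-hand side is the sum over the image of `castLE`, an injection
  have hinj : Function.Injective (Fin.castLE (show E₀ + 1 ≤ D + 1 by omega)) := Fin.castLE_injective _
  rw [← Finset.sum_image (f := F) (s := Finset.univ) (g := Fin.castLE (show E₀ + 1 ≤ D + 1 by omega))
    (fun x _ y _ h ↦ hinj h)]
  rw [← Finset.sum_filter_add_sum_filter_not Finset.univ (fun d : Fin (D + 1) ↦ (d : ℕ) ≤ E₀)]
  have h0 : ∑ d ∈ Finset.univ.filter (fun d : Fin (D + 1) ↦ ¬ (d : ℕ) ≤ E₀), (if (d : ℕ) ≤ E₀ then F d else 0) = 0 :=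
    Finset.sum_eq_zero fun d hd ↦ by rw [if_neg (Finset.mem_filter.1 hd).2]
  rw [h0, add_zero]
  have hset : Finset.univ.filter (fun d : Fin (D + 1) ↦ (d : ℕ) ≤ E₀)
      = Finset.univ.image (Fin.castLE (show E₀ + 1 ≤ D + 1 by omega)) := by
    ext d
    simp only [Finset.mem_filter, Finset.mem_univ, true_and, Finset.mem_image]
    constructor
    · intro hd
      exact ⟨⟨d, by omega⟩, Fin.ext rfl⟩
    · rintro ⟨e, rfl⟩
      simp only [Fin.val_castLE]
      omega
  rw [hset]
  refine Finset.sum_congr rfl fun d hd ↦ ?_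
  obtain ⟨e, -, rfl⟩ := Finset.mem_image.1 hd
  rw [if_pos (by simp only [Fin.val_castLE]; omega)]

/-- **Re-indexing the truncated family sum**: for the four tags and any per-tag weights `g t d`,
`Σ_{x : Fin 4 × Fin (D+1)} [x.2 ≤ E₀]·A(x)·g(x.1, x.2) = Σ_{y : Fin 4 × Fin (E₀+1)} A(y.1, castLE y.2)·g(y.1, y.2)`. -/
theorem sum_trunc_eq_sum_castLE {D E₀ : ℕ} (hE : E₀ ≤ D) (A : Fin 4 × Fin (D + 1) → ℝ) (g : Fin 4 → ℕ → ℝ) :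
    ∑ x : Fin 4 × Fin (D + 1), (if ((x.2 : ℕ)) ≤ E₀ then A x else 0) * g x.1 (x.2 : ℕ)
      = ∑ y : Fin 4 × Fin (E₀ + 1), A (y.1, Fin.castLE (by omega) y.2) * g y.1 (y.2 : ℕ) := by
  rw [Fintype.sum_prod_type, Fintype.sum_prod_type]
  refine Finset.sum_congr rfl fun t _ ↦ ?_
  have h := sum_fin_succ_trunc_eq hE (fun d : Fin (D + 1) ↦ A (t, d) * g t (d : ℕ))
  simp only [Fin.val_castLE] at h
  rw [← h]
  refine Finset.sum_congr rfl fun d _ ↦ ?_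
  split_ifs <;> simp

/-- **Truncation to the short index**: `collected_truncate` with the conclusion written over `Fin 4 × Fin (E₀+1)`
(`E + 1 ≤ E₀ ≤ D`). -/
theorem collected_truncate_short {X ε ρ : ℝ} {m₀ m : ℕ} (hm₀ : 1 ≤ m₀) (hm : m₀ ≤ m) {D E E₀ : ℕ}
    (hE : E + 1 ≤ E₀) (hED : E₀ ≤ D) (hε : |ε| ≤ 1) (A : Fin 4 × Fin (D + 1) → ℝ)
    (h : |X - ε * ∑ x : Fin 4 × Fin (D + 1), A x *
        (![(1 : ℝ), Real.log m, -(∑ n ∈ weilPrimeIndex a, (Λ n : ℝ) / Real.sqrt n * Real.cos (π * m / a * Real.log n)),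
          (∑ n ∈ weilPrimeIndex a, (Λ n : ℝ) / Real.sqrt n * Real.sin (π * m / a * Real.log n))] x.1
          / (m : ℝ) ^ (x.2 : ℕ))| ≤ ρ * ((m₀ : ℝ) / m) ^ (E + 1)) :
    |X - ε * ∑ y : Fin 4 × Fin (E₀ + 1), A (y.1, Fin.castLE (by omega) y.2) *
        (![(1 : ℝ), Real.log m, -(∑ n ∈ weilPrimeIndex a, (Λ n : ℝ) / Real.sqrt n * Real.cos (π * m / a * Real.log n)),
          (∑ n ∈ weilPrimeIndex a, (Λ n : ℝ) / Real.sqrt n * Real.sin (π * m / a * Real.log n))] y.1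
          / (m : ℝ) ^ (y.2 : ℕ))|
      ≤ (ρ + ∑ x : Fin 4 × Fin (D + 1), if E₀ < (x.2 : ℕ) then
          |A x| * (![(1 : ℝ), (m₀ : ℝ), ∑ n ∈ weilPrimeIndex a, (Λ n : ℝ) / Real.sqrt n,
            ∑ n ∈ weilPrimeIndex a, (Λ n : ℝ) / Real.sqrt n] x.1) / (m₀ : ℝ) ^ (x.2 : ℕ) else 0)
        * ((m₀ : ℝ) / m) ^ (E + 1) := by
  have ht := collected_truncate (a := a) hm₀ hm hE hε A h
  rw [sum_trunc_eq_sum_castLE hED A (fun t d ↦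
      (![(1 : ℝ), Real.log m, -(∑ n ∈ weilPrimeIndex a, (Λ n : ℝ) / Real.sqrt n * Real.cos (π * m / a * Real.log n)),
        (∑ n ∈ weilPrimeIndex a, (Λ n : ℝ) / Real.sqrt n * Real.sin (π * m / a * Real.log n))] t) / (m : ℝ) ^ d)] at ht
  exact ht

end Summit.RiemannHypothesis.RiemannHypothesis.Theorems.WeilFormatC
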